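import Literature.MathematicalPhysics.QuantumLattice.HubbardSliceSymbolSmoothXiThird
import Literature.Analysis.Calculus.IteratedDifferenceBound
import HarnessLib

/-!
# The single-scale slice symbol is `C³` in the FREQUENCY: `‖∂_ω³ Ψ_ξ(ω)‖ ≤ (64B₃ + 480B₂ + 1728B₁ + 1536)·c/Λ⁴`, and its third
# frequency differences

Topic `MathematicalPhysics/QuantumLattice`; the frequency twin of `HubbardSliceSymbolSmoothXiThird` (third derivative in the band variable
`ξ`).  `HubbardSliceSymbolSmooth` makes the symbol `Ψ_ξ(ω) = W(ω)·R(ω)` of the shifted Salmhofer slice `C^θ_{(Λ,Λ′]}` a `C²` function of the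
Matsubara variable (`sliceSymbolFn`, `sliceSymbolFnD1`, `sliceSymbolFnD2`, `‖Ψ″‖ ≤ (32B₂+144B₁+128)c/Λ³`); `…XiThird` adds the third derivative of
the WEIGHT in its last slot (`sliceWeightFnD3`, `hasDerivAt_sliceWeightFnD2`, `|W‴| ≤ (16B₃+24B₂)/Λ³`).  The WEIGHTED (first-moment) `ℓ¹` bounds of
the sectorised slice propagators (Benfatto–Giuliani–Mastropietro 2006, Lemma 2.2 with one moment: three summations by parts in EVERY direction,
including imaginary time) read third TIME differences of the symbol; here is the missing resolvent/symbol layer in the frequency slot: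

* §1 `resolventFnD3`, `hasDerivAt_resolventFnD2`, `norm_resolventFnD3` — `∂_ω³ R = −6ic/(−i(ω+θ)+ξ)⁴`, `‖∂_ω³R‖ = 6c/|·|⁴`;
* §2 `sliceSymbolFnD3` (`Ψ‴ = W‴R + 3W″R′ + 3W′R″ + WR‴`), **`hasDerivAt_sliceSymbolFnD2`**, **`norm_sliceSymbolFnD3_le`**
  (`‖Ψ‴‖ ≤ (64B₃+480B₂+1728B₁+1536)·c/Λ⁴` everywhere; `c ≥ 0`, `0 < Λ ≤ Λ′`, `|θ| ≤ Λ/4`; `B₁, B₂, B₃` global bounds of `χ₂′, χ₂″, χ₂‴`);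
* §3 **`norm_fwdDiff_iter_three_sliceSymbolFn_le`** — `‖Δ_δ³ Ψ_ξ(ω)‖ ≤ δ³·(64B₃+480B₂+1728B₁+1536)·c/Λ⁴` (`δ ≥ 0`; the Matsubara step `δ = 2π/β`).

Everything is proved; no named facts.

## Sources

G. Benfatto, A. Giuliani, V. Mastropietro, Ann. Henri Poincaré 7 (2006) 809–898, (2.36aa), §2.1 (2.3), Lemma 2.2 (2.52) (`BenfattoGiulianiMastropietro2006`);
M. Salmhofer, *Renormalization* (1999), §4.2.5 (4.70)–(4.71) (`Salmhofer1999`).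
-/

noncomputable section

namespace Literature.MathematicalPhysics.QuantumLattice

open Literature.Probability.LatticeModels Set Complex

/-! ### §1 The third frequency derivative of the resolvent factor -/

/-- `∂_ω³ R = −6ic/(−i(ω+θ)+ξ)⁴`. [cite: BenfattoGiulianiMastropietro2006, §2.1 (2.3)] -/
def resolventFnD3 (c θ ξ ω : ℝ) : ℂ := -6 * (c : ℂ) * I / (-I * ((ω + θ : ℝ) : ℂ) + (ξ : ℂ)) ^ 4

/-- `R‴`: for a nonzero denominator, `R″` has derivative `resolventFnD3`. [cite: BenfattoGiulianiMastropietro2006, §2.1 (2.3)] -/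
theorem hasDerivAt_resolventFnD2 {c θ ξ ω : ℝ} (h : (-I * ((ω + θ : ℝ) : ℂ) + (ξ : ℂ)) ≠ 0) :
    HasDerivAt (resolventFnD2 c θ ξ) (resolventFnD3 c θ ξ ω) ω := by
  unfold resolventFnD2 resolventFnD3
  have h3 : (-I * ((ω + θ : ℝ) : ℂ) + (ξ : ℂ)) ^ 3 ≠ 0 := pow_ne_zero 3 h
  have hcb : HasDerivAt (fun t : ℝ => (-I * ((t + θ : ℝ) : ℂ) + (ξ : ℂ)) ^ 3)
      ((3 : ℕ) * (-I * ((ω + θ : ℝ) : ℂ) + (ξ : ℂ)) ^ (3 - 1) * (-I * 1)) ω :=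
    (hasDerivAt_shiftDen θ ξ ω).pow 3
  have hinv := ((hasDerivAt_inv h3).comp ω hcb).const_mul (-2 * (c : ℂ))
  refine (hinv.congr_of_eventuallyEq (Filter.Eventually.of_forall fun t => ?_)).congr_deriv ?_
  · simp only [Function.comp, div_eq_mul_inv]
  · set a : ℂ := -I * ((ω + θ : ℝ) : ℂ) + (ξ : ℂ) with ha
    have h4 : a ^ 4 ≠ 0 := pow_ne_zero 4 h
    have h6 : (a ^ 3) ^ 2 ≠ 0 := pow_ne_zero 2 h3
    rw [show (3 : ℕ) - 1 = 2 from rfl]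
    field_simp
    ring

/-- `‖∂_ω³ R‖ = 6c/|a|⁴`. [cite: BenfattoGiulianiMastropietro2006, §2.1 (2.3)] -/
theorem norm_resolventFnD3 {c : ℝ} (hc : 0 ≤ c) (θ ξ ω : ℝ) :
    ‖resolventFnD3 c θ ξ ω‖ = 6 * c / ‖-I * ((ω + θ : ℝ) : ℂ) + (ξ : ℂ)‖ ^ 4 := by
  rw [resolventFnD3, norm_div, norm_mul, norm_mul, norm_neg, Complex.norm_real, Real.norm_eq_abs, abs_of_nonneg hc, Complex.norm_I,
    norm_pow]
  norm_num

/-! ### §2 The third frequency derivative of the slice symbol -/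

/-- `Ψ‴ = W‴R + 3W″R′ + 3W′R″ + WR‴` (in the frequency). [cite: Salmhofer1999, §4.2.5 (4.70)] -/
def sliceSymbolFnD3 (c θ Λ Λ' ξ ω : ℝ) : ℂ :=
  (sliceWeightFnD3 Λ Λ' ξ ω : ℂ) * resolventFn c θ ξ ω + 3 * ((sliceWeightFnD2 Λ Λ' ξ ω : ℂ) * resolventFnD1 c θ ξ ω) +
    3 * ((sliceWeightFnD1 Λ Λ' ξ ω : ℂ) * resolventFnD2 c θ ξ ω) + (sliceWeightFn Λ Λ' ξ ω : ℂ) * resolventFnD3 c θ ξ ω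

section Symbol

variable {c θ Λ Λ' ξ : ℝ}

/-- **`Ψ″` is differentiable in the frequency everywhere, with derivative `Ψ‴`.** [cite: BenfattoGiulianiMastropietro2006, (2.36aa)] -/
theorem hasDerivAt_sliceSymbolFnD2 (hΛ : 0 < Λ) (hΛΛ' : Λ ≤ Λ') (hθ : |θ| ≤ Λ / 4) (ω : ℝ) :
    HasDerivAt (sliceSymbolFnD2 c θ Λ Λ' ξ) (sliceSymbolFnD3 c θ Λ Λ' ξ ω) ω := by
  by_cases h : Λ ^ 2 / 5 < ω ^ 2 + ξ ^ 2
  · have hne := shiftDen_ne_zero_of_gt hθ h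
    unfold sliceSymbolFnD2 sliceSymbolFnD3
    have hA := (hasDerivAt_sliceWeightFnD2 Λ Λ' ξ ω).ofReal_comp.mul (hasDerivAt_resolventFn (c := c) hne)
    have hB := ((hasDerivAt_sliceWeightFnD1 Λ Λ' ξ ω).ofReal_comp.mul (hasDerivAt_resolventFnD1 (c := c) hne)).const_mul (2 : ℂ)
    have hC := (hasDerivAt_sliceWeightFn Λ Λ' ξ ω).ofReal_comp.mul (hasDerivAt_resolventFnD2 (c := c) hne)
    refine ((hA.add hB).add hC).congr_deriv ?_
    ring
  · have hlt : ω ^ 2 + ξ ^ 2 < Λ ^ 2 / 4 := by linarith [not_lt.1 h, pow_pos hΛ 2]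
    have hopen : ∀ᶠ t in nhds ω, t ^ 2 + ξ ^ 2 < Λ ^ 2 / 4 :=
      (continuous_pow 2 |>.add continuous_const).continuousAt.eventually_lt continuousAt_const hlt
    have hev : sliceSymbolFnD2 c θ Λ Λ' ξ =ᶠ[nhds ω] fun _ => (0 : ℂ) := by
      filter_upwards [hopen] with t ht
      obtain ⟨h0, h1, h2⟩ := sliceWeightFn_eq_zero_of_not_mem hΛ hΛΛ' (ξ := ξ) (ω := t) (Or.inl ht)
      rw [sliceSymbolFnD2, h0, h1, h2, Complex.ofReal_zero]
      ring
    have hD3 : sliceSymbolFnD3 c θ Λ Λ' ξ ω = 0 := by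
      obtain ⟨h0, h1, h2⟩ := sliceWeightFn_eq_zero_of_not_mem hΛ hΛΛ' (ξ := ξ) (ω := ω) (Or.inl hlt)
      have h3 := sliceWeightFnD3_eq_zero_of_not_mem hΛ hΛΛ' (ξ := ξ) (ω := ω) (Or.inl hlt)
      rw [sliceSymbolFnD3, h0, h1, h2, h3, Complex.ofReal_zero]
      ring
    rw [hD3]
    exact (hasDerivAt_const ω (0 : ℂ)).congr_of_eventuallyEq hev

/-- **`‖∂_ω³Ψ‖ ≤ (64B₃ + 480B₂ + 1728B₁ + 1536)·c/Λ⁴`** everywhere (`c ≥ 0`, `0 < Λ ≤ Λ′`, `|θ| ≤ Λ/4`; `B₁, B₂, B₃` bounds of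
`χ₂′, χ₂″, χ₂‴`) — the same constant as for `∂_ξ³` (`…XiThird`): the resolvent's frequency and band derivatives have equal norms.
[cite: BenfattoGiulianiMastropietro2006, (2.36aa)] -/
theorem norm_sliceSymbolFnD3_le (hΛ : 0 < Λ) (hΛΛ' : Λ ≤ Λ') (hθ : |θ| ≤ Λ / 4) (hc : 0 ≤ c) {B₁ B₂ B₃ : ℝ}
    (hB₁ : ∀ x, |deriv salmhoferCutoff x| ≤ B₁) (hB₂ : ∀ x, |deriv (deriv salmhoferCutoff) x| ≤ B₂)
    (hB₃ : ∀ x, |deriv (deriv (deriv salmhoferCutoff)) x| ≤ B₃) (ω : ℝ) :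
    ‖sliceSymbolFnD3 c θ Λ Λ' ξ ω‖ ≤ (64 * B₃ + 480 * B₂ + 1728 * B₁ + 1536) * c / Λ ^ 4 := by
  have hB10 : 0 ≤ B₁ := (abs_nonneg _).trans (hB₁ 0)
  have hB20 : 0 ≤ B₂ := (abs_nonneg _).trans (hB₂ 0)
  have hB30 : 0 ≤ B₃ := (abs_nonneg _).trans (hB₃ 0)
  by_cases hmem : ω ^ 2 + ξ ^ 2 < Λ ^ 2 / 4 ∨ Λ' ^ 2 < ω ^ 2 + ξ ^ 2
  · obtain ⟨h0, h1, h2⟩ := sliceWeightFn_eq_zero_of_not_mem hΛ hΛΛ' hmem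
    have h3 := sliceWeightFnD3_eq_zero_of_not_mem hΛ hΛΛ' hmem
    rw [sliceSymbolFnD3, h0, h1, h2, h3, Complex.ofReal_zero]
    simp only [zero_mul, mul_zero, add_zero, norm_zero]
    positivity
  · rw [not_or, not_lt, not_lt] at hmem
    have hden := norm_shiftDen_ge hθ hmem.1
    set a := ‖-I * ((ω + θ : ℝ) : ℂ) + (ξ : ℂ)‖ with ha
    have ha0 : 0 < a := lt_of_lt_of_le (by positivity) hden
    have hR : ‖resolventFn c θ ξ ω‖ ≤ 4 * c / Λ := by
      rw [norm_resolventFn hc, div_le_div_iff₀ ha0 hΛ]; nlinarith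
    have hR1 : ‖resolventFnD1 c θ ξ ω‖ ≤ 16 * c / Λ ^ 2 := by
      rw [norm_resolventFnD1 hc, div_le_div_iff₀ (by positivity) (by positivity)]
      have : Λ ^ 2 ≤ 16 * a ^ 2 := by nlinarith
      nlinarith
    have hR2 : ‖resolventFnD2 c θ ξ ω‖ ≤ 128 * c / Λ ^ 3 := by
      rw [norm_resolventFnD2 hc, div_le_div_iff₀ (by positivity) (by positivity)]
      have : Λ ^ 3 ≤ 64 * a ^ 3 := by nlinarith [pow_le_pow_left₀ (by positivity : 0 ≤ Λ / 4) hden 3]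
      nlinarith
    have hR3 : ‖resolventFnD3 c θ ξ ω‖ ≤ 1536 * c / Λ ^ 4 := by
      rw [norm_resolventFnD3 hc, div_le_div_iff₀ (by positivity) (by positivity)]
      have : Λ ^ 4 ≤ 256 * a ^ 4 := by nlinarith [pow_le_pow_left₀ (by positivity : 0 ≤ Λ / 4) hden 4]
      nlinarith
    have hW : ‖(sliceWeightFn Λ Λ' ξ ω : ℂ)‖ ≤ 1 := by
      rw [Complex.norm_real, Real.norm_eq_abs]; exact abs_sliceWeightFn_le_one Λ Λ' ξ ω
    have hW1 : ‖(sliceWeightFnD1 Λ Λ' ξ ω : ℂ)‖ ≤ 4 * B₁ / Λ := by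
      rw [Complex.norm_real, Real.norm_eq_abs]; exact abs_sliceWeightFnD1_le hB₁ hΛ hΛΛ' ξ ω
    have hW2 : ‖(sliceWeightFnD2 Λ Λ' ξ ω : ℂ)‖ ≤ (8 * B₂ + 4 * B₁) / Λ ^ 2 := by
      rw [Complex.norm_real, Real.norm_eq_abs]; exact abs_sliceWeightFnD2_le hB₁ hB₂ hΛ hΛΛ' ξ ω
    have hW3 : ‖(sliceWeightFnD3 Λ Λ' ξ ω : ℂ)‖ ≤ (16 * B₃ + 24 * B₂) / Λ ^ 3 := by
      rw [Complex.norm_real, Real.norm_eq_abs]; exact abs_sliceWeightFnD3_le hB₂ hB₃ hΛ hΛΛ' ξ ω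
    rw [sliceSymbolFnD3]
    calc _ ≤ ‖(sliceWeightFnD3 Λ Λ' ξ ω : ℂ) * resolventFn c θ ξ ω‖ +
          ‖3 * ((sliceWeightFnD2 Λ Λ' ξ ω : ℂ) * resolventFnD1 c θ ξ ω)‖ +
          ‖3 * ((sliceWeightFnD1 Λ Λ' ξ ω : ℂ) * resolventFnD2 c θ ξ ω)‖ +
          ‖(sliceWeightFn Λ Λ' ξ ω : ℂ) * resolventFnD3 c θ ξ ω‖ := by
          refine (norm_add_le _ _).trans (add_le_add ((norm_add_le _ _).trans (add_le_add (norm_add_le _ _) le_rfl)) le_rfl)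
      _ ≤ (16 * B₃ + 24 * B₂) / Λ ^ 3 * (4 * c / Λ) + 3 * ((8 * B₂ + 4 * B₁) / Λ ^ 2 * (16 * c / Λ ^ 2)) +
          3 * (4 * B₁ / Λ * (128 * c / Λ ^ 3)) + 1 * (1536 * c / Λ ^ 4) := by
          refine add_le_add (add_le_add (add_le_add ?_ ?_) ?_) ?_
          · rw [norm_mul]; exact mul_le_mul hW3 hR (norm_nonneg _) (by positivity)
          · rw [norm_mul, norm_mul, Complex.norm_ofNat]
            exact mul_le_mul_of_nonneg_left (mul_le_mul hW2 hR1 (norm_nonneg _) (by positivity)) (by norm_num)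
          · rw [norm_mul, norm_mul, Complex.norm_ofNat]
            exact mul_le_mul_of_nonneg_left (mul_le_mul hW1 hR2 (norm_nonneg _) (by positivity)) (by norm_num)
          · rw [norm_mul]; exact mul_le_mul hW hR3 (norm_nonneg _) zero_le_one
      _ = (64 * B₃ + 480 * B₂ + 1728 * B₁ + 1536) * c / Λ ^ 4 := by field_simp; ring

/-! ### §3 Third frequency differences -/

/-- **Third frequency differences of the slice symbol**: `‖Δ_δ³ Ψ_ξ(ω)‖ ≤ δ³·(64B₃ + 480B₂ + 1728B₁ + 1536)·c/Λ⁴` for `δ ≥ 0` (iterated mean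
value inequality along the chain `Ψ, Ψ′, Ψ″, Ψ‴`). [cite: BenfattoGiulianiMastropietro2006, Lemma 2.2 (2.52)] -/
theorem norm_fwdDiff_iter_three_sliceSymbolFn_le (hΛ : 0 < Λ) (hΛΛ' : Λ ≤ Λ') (hθ : |θ| ≤ Λ / 4) (hc : 0 ≤ c) {B₁ B₂ B₃ : ℝ}
    (hB₁ : ∀ x, |deriv salmhoferCutoff x| ≤ B₁) (hB₂ : ∀ x, |deriv (deriv salmhoferCutoff) x| ≤ B₂)
    (hB₃ : ∀ x, |deriv (deriv (deriv salmhoferCutoff)) x| ≤ B₃) {δ : ℝ} (hδ : 0 ≤ δ) (ω : ℝ) :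
    ‖(fwdDiff δ)^[3] (sliceSymbolFn c θ Λ Λ' ξ) ω‖ ≤ δ ^ 3 * ((64 * B₃ + 480 * B₂ + 1728 * B₁ + 1536) * c / Λ ^ 4) := by
  set G : ℕ → ℝ → ℂ := fun k t =>
      if k = 0 then sliceSymbolFn c θ Λ Λ' ξ t
      else if k = 1 then sliceSymbolFnD1 c θ Λ Λ' ξ t
      else if k = 2 then sliceSymbolFnD2 c θ Λ Λ' ξ t
      else if k = 3 then sliceSymbolFnD3 c θ Λ Λ' ξ t
      else 0 with hG
  have hchain : ∀ k < 3, ∀ t, HasDerivAt (G k) (G (k + 1) t) t := by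
    intro k hk t
    interval_cases k
    · show HasDerivAt (fun t => sliceSymbolFn c θ Λ Λ' ξ t) (sliceSymbolFnD1 c θ Λ Λ' ξ t) t
      exact hasDerivAt_sliceSymbolFn hΛ hΛΛ' hθ t
    · show HasDerivAt (fun t => sliceSymbolFnD1 c θ Λ Λ' ξ t) (sliceSymbolFnD2 c θ Λ Λ' ξ t) t
      exact hasDerivAt_sliceSymbolFnD1 hΛ hΛΛ' hθ t
    · show HasDerivAt (fun t => sliceSymbolFnD2 c θ Λ Λ' ξ t) (sliceSymbolFnD3 c θ Λ Λ' ξ t) t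
      exact hasDerivAt_sliceSymbolFnD2 hΛ hΛΛ' hθ t
  have h := Literature.Analysis.norm_fwdDiff_iter_le_of_hasDerivAt hδ 3 G ω ((64 * B₃ + 480 * B₂ + 1728 * B₁ + 1536) * c / Λ ^ 4)
    (fun k hk s _ => hchain k hk s) (fun s _ => by
      show ‖G 3 s‖ ≤ _
      have : G 3 s = sliceSymbolFnD3 c θ Λ Λ' ξ s := by simp [hG]
      rw [this]; exact norm_sliceSymbolFnD3_le hΛ hΛΛ' hθ hc hB₁ hB₂ hB₃ s)
  have h0 : G 0 = sliceSymbolFn c θ Λ Λ' ξ := by funext s; simp [hG]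
  rw [h0] at h
  exact h

end Symbol

end Literature.MathematicalPhysics.QuantumLattice

end
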